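import Summits.MatrixMultiplication.MatrixMultiplication.Theorems.OutsiderSandwichPencilSlack

/-!
# Outsider sandwich — the pencil slack law, `m = 2` column (K38-2g)

decomp-mm lens-4, generation 38, Part IIg (helper toward `LaserTangency`, stmt-32268; theses-free,
definition-free).  Part IIe transported the pencil law of `cw₂^{⊠N}` along the `m`-space of covectors
`Z_{0ν}` of one copy (slices of rank `≤ m`), which needs `m ≥ 3`.  For `m = 2` that space is only
`2`-dimensional; here the pencil is the whole covector space of ONE COPY (`m²`-dimensional, slices of
rank `≤ m²`), which gives, for every `m ≥ 2`,

* `rank_sliceMat_pack_copy_le` — covectors of `F·⟨m,m,m⟩` supported on one copy have slices of rank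
  `≤ m·m`;
* `pencil_slack_law_copy` — `2 ≤ m`, `cw₂^{⊠N} ≥ F·⟨m,m,m⟩ ⟹ 3·2^N + 4·F·m² ≤ 2·m² + 4·3^N`
  (for `m ≥ 3` Part IIe is stronger; for `m = 2`: `16·F ≤ 8 + 4·3^N − 3·2^N`, versus Part I's
  `16·F ≤ 4 + 4·3^N − 2·2^N`);
* cells decided beyond Part I in the `m = 2` column: `6·⟨2,2,2⟩ ≰ cw₂^{⊠3}` (Part I and the volume
  bound allow `6`; so at most `5` disjoint `2 × 2` matrix products restrict from `cw₂^{⊠3}`),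
  `18·⟨2,2,2⟩ ≰ cw₂^{⊠4}` (Part I: `19`), `56·⟨2,2,2⟩ ≰ cw₂^{⊠5}` (Part I: `58`),
  `171·⟨2,2,2⟩ ≰ cw₂^{⊠6}` (Part I: `175`).

References.
* D. Coppersmith, S. Winograd, *Matrix multiplication via arithmetic progressions*,
  J. Symbolic Comput. 9 (1990) 251–280, §6. [CoppersmithWinograd1990]
* M. Bläser, C. Ikenmeyer, V. Lysikov, A. Pandey, F.-O. Schreyer, *Variety membership testing,
  algebraic natural proofs, and geometric complexity theory*, arXiv:1911.02534, Def. 13 (minrank).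
  [BlaserIkenmeyerLysikovPandeySchreyer2019]
* R. A. Horn, C. R. Johnson, *Matrix Analysis*, 2nd ed., CUP 2013, §0.4.5. [HornJohnson2013]
-/

set_option linter.dupNamespace false

namespace Summit.MatrixMultiplication.MatrixMultiplication.Theorems.OutsiderSandwichPencilSlackTwo

open Literature.Computability.AlgebraicComplexity
open OutsiderSandwichNoExactPerfection OutsiderSandwichNoExactPerfectPacking
open OutsiderSandwichPackingSlack OutsiderSandwichPencilLaw OutsiderSandwichPencilSlack
open scoped Matrix

/-- A covector of `F·⟨m,m,m⟩` supported on the forms of ONE copy `f₀` has slice of rank `≤ m·m`: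
its nonzero rows are indexed by the `m²` variables `X_{iμ}` of that copy. [folklore] -/
theorem rank_sliceMat_pack_copy_le (F m : ℕ) (f₀ : Fin F)
    (ξ : Fin F × (Fin m × Fin m) → ℂ) (hξ : ∀ a, ξ a ≠ 0 → a.1 = f₀) :
    (sliceMat (kroneckerTensor (unitTensor ℂ F) (matMulTensor ℂ m m m)) ξ).rank ≤ m * m := by
  classical
  set M := sliceMat (kroneckerTensor (unitTensor ℂ F) (matMulTensor ℂ m m m)) ξ with hM
  have hrow : ∀ b c, b.1 ≠ f₀ → M b c = 0 := by
    intro b c hb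
    rw [hM, sliceMat_eq_contract3, contract3_apply]
    refine Finset.sum_eq_zero fun a _ => ?_
    by_cases ha : ξ a = 0
    · rw [ha, zero_mul]
    · have h1 := hξ a ha
      simp only [kroneckerTensor_apply, unitTensor_apply, matMulTensor]
      by_cases hP : a.1 = b.1 ∧ b.1 = c.1
      · exact absurd (hP.1.symm.trans h1) hb
      · rw [if_neg hP, zero_mul, mul_zero]
  let g : Fin m × Fin m → Fin F × (Fin m × Fin m) := fun p => (f₀, p)
  let P : Matrix (Fin F × (Fin m × Fin m)) (Fin m × Fin m) ℂ := fun b p => if b = g p then 1 else 0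
  have hfac : M = P * M.submatrix g id := by
    ext b c
    rw [Matrix.mul_apply]
    by_cases hb : b.1 = f₀
    · have hbg : b = g b.2 := by
        obtain ⟨f, p⟩ := b
        simp only at hb
        subst hb
        rfl
      rw [Finset.sum_eq_single b.2]
      · simp [P, ← hbg]
      · intro p _ hp
        have hne : b ≠ g p := by
          intro h
          apply hp
          have := congr_arg (fun x : Fin F × (Fin m × Fin m) => x.2) h
          simpa [g] using this.symm
        simp [P, hne]
      · simp
    · rw [hrow b c hb]
      refine (Finset.sum_eq_zero fun p _ => ?_).symm
      have hne : b ≠ g p := by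
        rintro rfl
        exact hb rfl
      simp [P, hne]
  rw [hfac]
  calc (P * M.submatrix g id).rank ≤ P.rank := Matrix.rank_mul_le_left _ _
    _ ≤ Fintype.card (Fin m × Fin m) := Matrix.rank_le_card_width _
    _ = m * m := by rw [Fintype.card_prod, Fintype.card_fin]

/-- **Pencil slack law, one-copy pencil.**  `2 ≤ m`, `0 < F`, `cw₂^{⊠N} ≥ F·⟨m,m,m⟩ ⟹
3·2^N + 4·F·m² ≤ 2·m² + 4·3^N`.  For `m = 2`: `16F ≤ 8 + 4·3^N − 3·2^N`.
[cite: CoppersmithWinograd1990, §6; BlaserIkenmeyerLysikovPandeySchreyer2019, Def. 13] -/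
theorem pencil_slack_law_copy {N F m : ℕ} (hF : 0 < F) (hm : 2 ≤ m)
    (h : TensorRestrictsTo (kroneckerPow (cwTensor ℂ 2) N)
      (kroneckerTensor (unitTensor ℂ F) (matMulTensor ℂ m m m))) :
    3 * 2 ^ N + 4 * (F * m ^ 2) ≤ 2 * m ^ 2 + 4 * 3 ^ N := by
  classical
  haveI : NeZero m := ⟨by omega⟩
  let D : Fin 3 → Fin 3 → Fin 3 → ℂ := fun a b c => if a ≠ b ∧ b ≠ c ∧ a ≠ c then 1 else 0
  have hD : ∀ a b c, D a b c = if a ≠ b ∧ b ≠ c ∧ a ≠ c then 1 else 0 := fun _ _ _ => rfl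
  have hres : TensorRestrictsTo (kroneckerPow D N)
      (kroneckerTensor (unitTensor ℂ F) (matMulTensor ℂ m m m)) :=
    ((restrictsTo_cwTwo hD).kroneckerPow N).trans h
  have hfloor : ∀ W : Submodule ℂ ((Fin N → Fin 3) → ℂ), 3 ≤ Module.finrank ℂ ↥W →
      ∃ η ∈ W, 3 * 2 ^ N ≤ 2 * (sliceMat (kroneckerPow D N) η).rank :=
    fun W hW => pencil_law hD N W hW
  let f₀ : Fin F := ⟨0, hF⟩
  let Lc : (Fin m × Fin m → ℂ) →ₗ[ℂ] (Fin F × (Fin m × Fin m) → ℂ) :=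
    { toFun := fun c a => if a.1 = f₀ then c a.2 else 0
      map_add' := fun x y => by
        funext a
        by_cases ha : a.1 = f₀ <;> simp [ha]
      map_smul' := fun s x => by
        funext a
        by_cases ha : a.1 = f₀ <;> simp [ha] }
  have hLc : ∀ c a, Lc c a = if a.1 = f₀ then c a.2 else 0 := fun _ _ => rfl
  have hinj : Function.Injective Lc := by
    intro x y hxy
    funext p
    have := congr_fun hxy (f₀, p)
    simpa [hLc] using this
  have hU : 3 ≤ Module.finrank ℂ ↥(LinearMap.range Lc) := by
    rw [LinearMap.finrank_range_of_inj hinj, Module.finrank_fintype_fun_eq_card, Fintype.card_prod,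
      Fintype.card_fin]
    nlinarith
  have hρ : ∀ ξ ∈ LinearMap.range Lc,
      (sliceMat (kroneckerTensor (unitTensor ℂ F) (matMulTensor ℂ m m m)) ξ).rank ≤ m * m := by
    rintro _ ⟨c, rfl⟩
    refine rank_sliceMat_pack_copy_le F m f₀ _ fun a ha => ?_
    by_contra hcon
    exact ha (by rw [hLc, if_neg hcon])
  have key := floor3_le_of_restricts hfloor (linearIndependent_pack F m)
    (linearIndependent_rotate_pack F m) (linearIndependent_rotate_rotate_pack F m) _ hU hρ hres
  simp only [Fintype.card_prod, Fintype.card_fin, Fintype.card_fun] at key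
  rw [sq]
  generalize F * (m * m) = V at key ⊢
  generalize m * m = W at key ⊢
  omega

/-- `6·⟨2,2,2⟩ ≰ cw₂^{⊠3}`: at most `5` disjoint `2 × 2` matrix products restrict from `cw₂^{⊠3}`
(Part I and the volume bound `4F ≤ 27` allow `6`). -/
theorem not_pack_six_two_le_cwPow_three :
    ¬ TensorRestrictsTo (kroneckerPow (cwTensor ℂ 2) 3)
      (kroneckerTensor (unitTensor ℂ 6) (matMulTensor ℂ 2 2 2)) := by
  intro h
  have := pencil_slack_law_copy (by norm_num) le_rfl h
  norm_num at this

/-- `18·⟨2,2,2⟩ ≰ cw₂^{⊠4}` (Part I excluded `19`, volume allows `20`). -/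
theorem not_pack_eighteen_two_le_cwPow_four :
    ¬ TensorRestrictsTo (kroneckerPow (cwTensor ℂ 2) 4)
      (kroneckerTensor (unitTensor ℂ 18) (matMulTensor ℂ 2 2 2)) := by
  intro h
  have := pencil_slack_law_copy (by norm_num) le_rfl h
  norm_num at this

/-- `56·⟨2,2,2⟩ ≰ cw₂^{⊠5}` (Part I excluded `58`, volume allows `60`). -/
theorem not_pack_fiftysix_two_le_cwPow_five :
    ¬ TensorRestrictsTo (kroneckerPow (cwTensor ℂ 2) 5)
      (kroneckerTensor (unitTensor ℂ 56) (matMulTensor ℂ 2 2 2)) := by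
  intro h
  have := pencil_slack_law_copy (by norm_num) le_rfl h
  norm_num at this

/-- `171·⟨2,2,2⟩ ≰ cw₂^{⊠6}` (Part I excluded `175`, volume allows `182`). -/
theorem not_pack_onehundredseventyone_two_le_cwPow_six :
    ¬ TensorRestrictsTo (kroneckerPow (cwTensor ℂ 2) 6)
      (kroneckerTensor (unitTensor ℂ 171) (matMulTensor ℂ 2 2 2)) := by
  intro h
  have := pencil_slack_law_copy (by norm_num) le_rfl h
  norm_num at this

/-- The `m = 2` column in closed form: `F` copies of `⟨2,2,2⟩` inside `cw₂^{⊠N}` obey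
`3·2^N + 16F ≤ 8 + 4·3^N`. [this file] -/
theorem sixteen_mul_le_of_pack_two {N F : ℕ} (hF : 0 < F)
    (h : TensorRestrictsTo (kroneckerPow (cwTensor ℂ 2) N)
      (kroneckerTensor (unitTensor ℂ F) (matMulTensor ℂ 2 2 2))) :
    3 * 2 ^ N + 16 * F ≤ 8 + 4 * 3 ^ N := by
  have := pencil_slack_law_copy hF le_rfl h
  norm_num at this
  omega

end Summit.MatrixMultiplication.MatrixMultiplication.Theorems.OutsiderSandwichPencilSlackTwo
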